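import Summits.AtomisticToContinuum.HydrodynamicLimit.Theorems.CollisionIsometryCLTMacroClosureStubLedgerScaling

/-!
# The squeeze `SqueezeToBlockGibbs` (route JaynesSqueeze), 0: local Gibbs laws with bounded measurable parameters

Helper file (`--supports stmt-AtomisticToContinuum-13463`) for the support item `SqueezeToBlockGibbs` of route
`JaynesSqueeze`. The block-constant references of the waypoint `BlockGibbs` have merely MEASURABLE parameters with
two-sided bounds (`r_lo ≤ a ≤ r_hi`, `0 < θ`), whereas the tree's local Gibbs API (`HardSphereEulerProofs`) is stated
for continuous profiles (continuity is used there only for measurability and boundedness). This file records, in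
the two-sided-bounds currency the squeeze uses, the facts it needs: the canonical partition function is the
configurational one and is positive, the laws are probability measures, the positive Liouville density
`Z⁻¹ ∏ prof(zₖ)` has logarithm `(N+1)⟨emp z, log prof⟩ − log Z`, and the log-pairing through a measurable map is
measurable. The proofs follow the continuous ones of `HardSphereEulerProofs` line by line (disintegration into
positions and conditionally Gaussian velocities); cf. the parallel file
`JaynesSqueezeBlockGibbsMeasurableProfiles` of the `BlockGibbs` line, which states the one-sided-bound versions.

References: Spohn 1991 Part I §2.3.
-/

noncomputable section

open MeasureTheory Filter Set Topology
open scoped ENNReal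

namespace Summit.AtomisticToContinuum.HydrodynamicLimit.Theorems.JaynesSqueezeSqueeze

open Literature.MathematicalPhysics.KineticTheory Literature.Analysis.FluidPDE
open Literature.Analysis.FunctionSpaces
open MacroClosureLine.StubLedger

variable {a₀ θ₀ : T3 → ℝ} {u₀ : T3 → V3}

/-- The local Gibbs profile `a(x) M_{1,u(x),θ(x)}(v)` of measurable parameters is strongly measurable. [folklore] -/
theorem stronglyMeasurable_localGibbsProfile (ha : Measurable a₀) (hθ : Measurable θ₀) (hu : Measurable u₀) :
    StronglyMeasurable (localGibbsProfile a₀ u₀ θ₀) := by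
  refine Measurable.stronglyMeasurable ?_
  unfold localGibbsProfile localMaxwellian
  refine (ha.comp measurable_fst).mul ((measurable_const.mul ?_).mul ?_)
  · exact ((measurable_const.mul (hθ.comp measurable_fst)).pow_const _)
  · refine Real.measurable_exp.comp ?_
    exact ((measurable_snd.sub (hu.comp measurable_fst)).norm.pow_const 2).neg.div
      (measurable_const.mul (hθ.comp measurable_fst))

/-- The empirical log-profile pairing through a measurable map of phase space is measurable (measurable
parameters). [folklore] -/
theorem measurable_logPair_comp {N : ℕ} {T : Config (N + 1) (Fin 3) T3 → Config (N + 1) (Fin 3) T3}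
    (hT : Measurable T) (ha : Measurable a₀) (hθ : Measurable θ₀) (hu : Measurable u₀) :
    Measurable fun z : Config (N + 1) (Fin 3) T3 =>
      (∫ y, Real.log (localGibbsProfile a₀ u₀ θ₀ y) ∂(empiricalMeasure (T z))) := by
  simp_rw [logPair_eq_sum]
  refine measurable_const.mul (Finset.measurable_sum _ fun k _ => ?_)
  have h1 : Measurable fun z : Config (N + 1) (Fin 3) T3 => localGibbsProfile a₀ u₀ θ₀ (T z k) :=
    (stronglyMeasurable_localGibbsProfile ha hθ hu).measurable.comp ((measurable_pi_apply k).comp hT)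
  exact Real.measurable_log.comp h1

/-! ## Disintegration (positive measurable activity) -/

-- adapted from `Literature.MathematicalPhysics.KineticTheory.lintegral_gibbsWeight_mul` (continuous profiles)
/-- Disintegration of the unnormalised local Gibbs weight of measurable parameters with `a, θ > 0` into positions
and velocities: `∫ 𝟙_{D_ε} f^{⊗n} G dz = ∫ dx 𝟙_{no overlap}(x) ∏ a(xᵢ) ∫ G(x, v) ⊗ᵢ N(u(xᵢ), θ(xᵢ))(dv)` for
measurable `G ≥ 0`. [folklore] -/
theorem lintegral_gibbsWeight_mul_of_pos (ha : Measurable a₀) (hθ : Measurable θ₀) (hu : Measurable u₀)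
    (ha0 : ∀ x, 0 < a₀ x) (hθ0 : ∀ x, 0 < θ₀ x) (ε : ℝ) (n : ℕ)
    {G : Config n (Fin 3) T3 → ℝ≥0∞} (hG : Measurable G) :
    ∫⁻ z, ENNReal.ofReal ((hardSphereDomain (Torus.geometry (Fin 3)) n ε).indicator
        (tensorPow n (localGibbsProfile a₀ u₀ θ₀)) z) * G z =
      ∫⁻ x, ENNReal.ofReal (posWeight a₀ ε n x) * ∫⁻ v, G (zipConfig (x, v)) ∂velMeasure u₀ θ₀ x := by
  set F : Config n (Fin 3) T3 → ℝ := (hardSphereDomain (Torus.geometry (Fin 3)) n ε).indicator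
    (tensorPow n (localGibbsProfile a₀ u₀ θ₀)) with hF
  have hFm : Measurable fun z => ENNReal.ofReal (F z) :=
    ((measurable_tensorPow (stronglyMeasurable_localGibbsProfile ha hθ hu).measurable n).indicator
      (measurableSet_hardSphereDomain _ Torus.measurable_geometry_sepVec n ε)).ennreal_ofReal
  set Mx : (Fin n → T3) → (Fin n) → V3 → ℝ≥0∞ :=
    fun x i w => ENNReal.ofReal (localMaxwellian 1 (θ₀ (x i)) (u₀ (x i)) w) with hMx
  have hMm : ∀ x i, Measurable (Mx x i) := fun x i =>
    (continuous_localMaxwellian 1 (θ₀ (x i)) (u₀ (x i))).measurable.ennreal_ofReal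
  have hpt : ∀ (x : Fin n → T3) (v : Fin n → V3),
      ENNReal.ofReal (F (zipConfig (x, v))) = ENNReal.ofReal (posWeight a₀ ε n x) * ∏ i, Mx x i (v i) := by
    intro x v
    rw [hF, indicator_tensorPow_zipConfig, ENNReal.ofReal_mul (posWeight_nonneg (fun y => (ha0 y).le) ε x),
      ENNReal.ofReal_prod_of_nonneg fun i _ => localMaxwellian_nonneg zero_le_one (hθ0 (x i)).le _ _]
  have hvel : ∀ x : Fin n → T3,
      (volume : Measure (Fin n → V3)).withDensity (fun v => ∏ i, Mx x i (v i)) = velMeasure u₀ θ₀ x := by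
    intro x
    have hσf : ∀ i, SigmaFinite ((volume : Measure V3).withDensity (Mx x i)) := fun i => by
      simp only [hMx]
      rw [withDensity_localMaxwellian_eq_gaussMeasure (hθ0 (x i))]
      infer_instance
    rw [volume_pi, ← pi_withDensity_eq (fun _ => volume) (hMm x) hσf, velMeasure]
    congr 1
    funext i
    exact withDensity_localMaxwellian_eq_gaussMeasure (hθ0 (x i)) (u₀ (x i))
  calc ∫⁻ z, ENNReal.ofReal (F z) * G z
      = ∫⁻ p, ENNReal.ofReal (F (zipConfig p)) * G (zipConfig p) ∂((volume : Measure (Fin n → T3)).prod volume) := by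
        rw [← measurePreserving_zipConfig.lintegral_comp_emb
          (MeasurableEquiv.arrowProdEquivProdArrow T3 V3 (Fin n)).symm.measurableEmbedding]
    _ = ∫⁻ x, ∫⁻ v, ENNReal.ofReal (F (zipConfig (x, v))) * G (zipConfig (x, v)) := by
        refine lintegral_prod _ ?_
        exact ((hFm.comp measurable_zipConfig).mul (hG.comp measurable_zipConfig)).aemeasurable
    _ = ∫⁻ x, ENNReal.ofReal (posWeight a₀ ε n x) * ∫⁻ v, (∏ i, Mx x i (v i)) * G (zipConfig (x, v)) := by
        refine lintegral_congr fun x => ?_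
        have hg' : Measurable fun v : Fin n → V3 => G (zipConfig (x, v)) :=
          hG.comp (measurable_zipConfig.comp (measurable_const.prodMk measurable_id))
        have hf' : Measurable fun v : Fin n → V3 => ∏ i, Mx x i (v i) :=
          Finset.measurable_prod _ fun i _ => (hMm x i).comp (measurable_pi_apply i)
        have hfg : Measurable fun v : Fin n → V3 => (∏ i, Mx x i (v i)) * G (zipConfig (x, v)) := hf'.mul hg'
        simp_rw [hpt x, mul_assoc]
        rw [lintegral_const_mul _ hfg]
    _ = ∫⁻ x, ENNReal.ofReal (posWeight a₀ ε n x) * ∫⁻ v, G (zipConfig (x, v)) ∂velMeasure u₀ θ₀ x := by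
        refine lintegral_congr fun x => ?_
        have hg' : Measurable fun v : Fin n → V3 => G (zipConfig (x, v)) :=
          hG.comp (measurable_zipConfig.comp (measurable_const.prodMk measurable_id))
        have hf' : Measurable fun v : Fin n → V3 => ∏ i, Mx x i (v i) :=
          Finset.measurable_prod _ fun i _ => (hMm x i).comp (measurable_pi_apply i)
        congr 1
        rw [← hvel x, lintegral_withDensity_eq_lintegral_mul _ hf' hg']
        rfl

/-- **The canonical partition function is the configurational one** (measurable parameters, `a, θ > 0`): the
Maxwellian velocity factors integrate to one. [folklore] -/
theorem canonicalPartition_eq_posPartition_of_pos (ha : Measurable a₀) (hθ : Measurable θ₀) (hu : Measurable u₀)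
    (ha0 : ∀ x, 0 < a₀ x) (hθ0 : ∀ x, 0 < θ₀ x) (ε : ℝ) (n : ℕ) :
    canonicalPartition (Torus.geometry (Fin 3)) ε n (localGibbsProfile a₀ u₀ θ₀) = posPartition a₀ ε n := by
  have hF0 : ∀ z, 0 ≤ (hardSphereDomain (Torus.geometry (Fin 3)) n ε).indicator
      (tensorPow n (localGibbsProfile a₀ u₀ θ₀)) z := fun z =>
    Set.indicator_nonneg (fun w _ =>
      tensorPow_nonneg (localGibbsProfile_nonneg (fun x => (ha0 x).le) fun x => (hθ0 x).le) n w) z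
  have hm1 : Measurable ((hardSphereDomain (Torus.geometry (Fin 3)) n ε).indicator
      (tensorPow n (localGibbsProfile a₀ u₀ θ₀))) :=
    (measurable_tensorPow (stronglyMeasurable_localGibbsProfile ha hθ hu).measurable n).indicator
      (measurableSet_hardSphereDomain _ Torus.measurable_geometry_sepVec n ε)
  have hm2 : Measurable (posWeight a₀ ε n) :=
    (Finset.measurable_prod _ fun i _ => ha.comp (measurable_pi_apply i)).indicator (measurableSet_posDomain ε n)
  rw [canonicalPartition, integral_eq_lintegral_of_nonneg_ae (Eventually.of_forall hF0) hm1.aestronglyMeasurable,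
    posPartition, integral_eq_lintegral_of_nonneg_ae
      (Eventually.of_forall fun x => posWeight_nonneg (fun y => (ha0 y).le) ε x) hm2.aestronglyMeasurable]
  congr 1
  have h := lintegral_gibbsWeight_mul_of_pos ha hθ hu ha0 hθ0 ε n (G := fun _ => 1) measurable_const
  simpa only [mul_one, lintegral_const, measure_univ] using h

/-! ## Positivity and normalisation under two-sided bounds -/

/-- The position weight of a measurable activity with `r_lo ≤ a ≤ r_hi`, `0 < r_lo`, is integrable and its integral
is the lower Lebesgue integral of its `ofReal`. [folklore] -/
theorem ofReal_posPartition_of_bounds (ha : Measurable a₀) {lo hi : ℝ} (hlo : 0 < lo)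
    (hb : ∀ x, lo ≤ a₀ x ∧ a₀ x ≤ hi) (ε : ℝ) (n : ℕ) :
    Integrable (posWeight a₀ ε n) ∧
      ENNReal.ofReal (posPartition a₀ ε n) = ∫⁻ x, ENNReal.ofReal (posWeight a₀ ε n x) := by
  have ha0 : ∀ x, 0 ≤ a₀ x := fun x => hlo.le.trans (hb x).1
  have hm : Measurable (posWeight a₀ ε n) :=
    (Finset.measurable_prod _ fun i _ => ha.comp (measurable_pi_apply i)).indicator (measurableSet_posDomain ε n)
  have hint : Integrable (posWeight a₀ ε n) := by
    refine (integrable_const (hi ^ n)).mono' hm.aestronglyMeasurable (Eventually.of_forall fun x => ?_)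
    rw [Real.norm_eq_abs, abs_of_nonneg (posWeight_nonneg ha0 ε x)]
    exact posWeight_le_pow ha0 (fun y => (hb y).2) ε x
  exact ⟨hint, ofReal_integral_eq_lintegral_ofReal hint (Eventually.of_forall fun x => posWeight_nonneg ha0 ε x)⟩

/-- **The configurational partition function is positive** at `σ ≤ 1/2` for a measurable activity with
`0 < r_lo ≤ a ≤ r_hi`: the non-overlap set has positive measure. [folklore] -/
theorem posPartition_pos_of_bounds (ha : Measurable a₀) {lo hi : ℝ} (hlo : 0 < lo)
    (hb : ∀ x, lo ≤ a₀ x ∧ a₀ x ≤ hi) {σ : ℝ} (hσ2 : σ ≤ 1 / 2) (N : ℕ) :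
    0 < posPartition a₀ (hsDiameter σ N) (N + 1) := by
  have ha0 : ∀ x, 0 ≤ a₀ x := fun x => hlo.le.trans (hb x).1
  rw [posPartition, integral_pos_iff_support_of_nonneg (fun x => posWeight_nonneg ha0 _ x)
    (ofReal_posPartition_of_bounds ha hlo hb _ _).1]
  refine lt_of_lt_of_le (volume_setOf_lt_euclidDist_pos hσ2 N) (measure_mono fun x hx => ?_)
  rw [Function.mem_support, posWeight,
    Set.indicator_of_mem (show x ∈ posDomain (hsDiameter σ N) (N + 1) from fun i j hij => (hx i j hij).le)]
  exact (Finset.prod_pos fun i _ => hlo.trans_le (hb (x i)).1).ne'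

/-- The canonical partition function of the local Gibbs profile of a measurable parameter triple with
`0 < r_lo ≤ a ≤ r_hi`, `0 < θ` is positive for `σ ≤ 1/2`. [folklore] -/
theorem canonicalPartition_pos_of_bounds (ha : Measurable a₀) (hθ : Measurable θ₀) (hu : Measurable u₀)
    {lo hi : ℝ} (hlo : 0 < lo) (hb : ∀ x, lo ≤ a₀ x ∧ a₀ x ≤ hi) (hθ0 : ∀ x, 0 < θ₀ x) {σ : ℝ} (hσ2 : σ ≤ 1 / 2)
    (N : ℕ) :
    0 < canonicalPartition (Torus.geometry (Fin 3)) (hsDiameter σ N) (N + 1) (localGibbsProfile a₀ u₀ θ₀) := by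
  rw [canonicalPartition_eq_posPartition_of_pos ha hθ hu (fun x => hlo.trans_le (hb x).1) hθ0]
  exact posPartition_pos_of_bounds ha hlo hb hσ2 N

-- adapted from `Literature.MathematicalPhysics.KineticTheory.localGibbsMeasure_univ` /
-- `isProbabilityMeasure_localGibbsLaw` (continuous profiles)
/-- **Local Gibbs laws with two-sided-bounded measurable parameters are probability measures**: measurable
`a, θ, u` with `0 < r_lo ≤ a ≤ r_hi`, `0 < θ`, reduced density `σ ≤ 1/2`, every particle number and flow.
[folklore] -/
theorem isProbabilityMeasure_localGibbsLaw_of_bounds (ha : Measurable a₀) (hθ : Measurable θ₀)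
    (hu : Measurable u₀) {lo hi : ℝ} (hlo : 0 < lo) (hb : ∀ x, lo ≤ a₀ x ∧ a₀ x ≤ hi) (hθ0 : ∀ x, 0 < θ₀ x)
    {σ : ℝ} (hσ2 : σ ≤ 1 / 2) (N : ℕ) (Φ : HardSphereFlow (Torus.geometry (Fin 3)) (hsDiameter σ N) (N + 1)) :
    IsProbabilityMeasure (localGibbsLaw σ a₀ u₀ θ₀ N Φ) := by
  have ha0 : ∀ x, 0 < a₀ x := fun x => hlo.trans_le (hb x).1
  set ε := hsDiameter σ N with hε
  set Z := canonicalPartition (Torus.geometry (Fin 3)) ε (N + 1) (localGibbsProfile a₀ u₀ θ₀) with hZ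
  have hZpos : 0 < Z := canonicalPartition_pos_of_bounds ha hθ hu hlo hb hθ0 hσ2 N
  have hZeq : Z = posPartition a₀ ε (N + 1) := canonicalPartition_eq_posPartition_of_pos ha hθ hu ha0 hθ0 ε (N + 1)
  obtain ⟨-, hofReal⟩ := ofReal_posPartition_of_bounds ha hlo hb ε (N + 1)
  refine ⟨?_⟩
  rw [localGibbsLaw_eq, localGibbsMeasure, withDensity_apply _ MeasurableSet.univ, Measure.restrict_univ]
  -- `∫⁻ Z⁻¹ 𝟙_D f^{⊗} = Z⁻¹ · Z_pos = 1`
  have h1 : ∫⁻ z, ENNReal.ofReal (canonicalDensity (Torus.geometry (Fin 3)) ε (N + 1)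
      (localGibbsProfile a₀ u₀ θ₀) z) = ENNReal.ofReal Z⁻¹ * ∫⁻ z, ENNReal.ofReal
        ((hardSphereDomain (Torus.geometry (Fin 3)) (N + 1) ε).indicator
          (tensorPow (N + 1) (localGibbsProfile a₀ u₀ θ₀)) z) * 1 := by
    rw [← lintegral_const_mul' _ _ ENNReal.ofReal_ne_top]
    refine lintegral_congr fun z => ?_
    rw [canonicalDensity, ENNReal.ofReal_mul (inv_nonneg.2 hZpos.le), mul_one]
  rw [h1, lintegral_gibbsWeight_mul_of_pos ha hθ hu ha0 hθ0 ε (N + 1) measurable_const]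
  simp only [lintegral_const, measure_univ, mul_one]
  rw [← hofReal, ← hZeq, ← ENNReal.ofReal_mul (inv_nonneg.2 hZpos.le), inv_mul_cancel₀ hZpos.ne',
    ENNReal.ofReal_one]

/-! ## The positive Liouville density and its logarithm -/

/-- The positive Gibbs density `Z⁻¹ ∏ prof(zₖ)` of positive parameters with positive partition function is
positive. [folklore] -/
theorem gibbsDensity_pos_of_pos {σ : ℝ} (N : ℕ) {a θ : T3 → ℝ} {u : T3 → V3} (ha0 : ∀ x, 0 < a x)
    (hθ0 : ∀ x, 0 < θ x)
    (hZ : 0 < canonicalPartition (Torus.geometry (Fin 3)) (hsDiameter σ N) (N + 1) (localGibbsProfile a u θ))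
    (z : Config (N + 1) (Fin 3) T3) :
    0 < (canonicalPartition (Torus.geometry (Fin 3)) (hsDiameter σ N) (N + 1) (localGibbsProfile a u θ))⁻¹ *
      tensorPow (N + 1) (localGibbsProfile a u θ) z :=
  mul_pos (inv_pos.2 hZ) (Finset.prod_pos fun k _ => localGibbsProfile_pos ha0 hθ0 (z k))

/-- **Bookkeeping of the positive Gibbs density** (positive parameters, positive partition function):
`log (Z⁻¹ ∏ₖ prof(zₖ)) = (N+1)·⟨emp z, log prof⟩ − log Z`. [folklore] -/
theorem log_gibbsDensity_of_pos {σ : ℝ} (N : ℕ) {a θ : T3 → ℝ} {u : T3 → V3} (ha0 : ∀ x, 0 < a x)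
    (hθ0 : ∀ x, 0 < θ x)
    (hZ : 0 < canonicalPartition (Torus.geometry (Fin 3)) (hsDiameter σ N) (N + 1) (localGibbsProfile a u θ))
    (z : Config (N + 1) (Fin 3) T3) :
    Real.log ((canonicalPartition (Torus.geometry (Fin 3)) (hsDiameter σ N) (N + 1) (localGibbsProfile a u θ))⁻¹ *
        tensorPow (N + 1) (localGibbsProfile a u θ) z) =
      ((N : ℝ) + 1) * (∫ y, Real.log (localGibbsProfile a u θ y) ∂(empiricalMeasure z)) -
        Real.log (canonicalPartition (Torus.geometry (Fin 3)) (hsDiameter σ N) (N + 1) (localGibbsProfile a u θ)) := by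
  have hp : ∀ k, localGibbsProfile a u θ (z k) ≠ 0 := fun k => (localGibbsProfile_pos ha0 hθ0 _).ne'
  simp only [tensorPow]
  rw [Real.log_mul (inv_ne_zero hZ.ne') (Finset.prod_ne_zero_iff.2 fun k _ => hp k), Real.log_inv,
    Real.log_prod fun k _ => hp k, logPair_eq_sum, ← mul_assoc, mul_inv_cancel₀ (by positivity), one_mul]
  ring

end Summit.AtomisticToContinuum.HydrodynamicLimit.Theorems.JaynesSqueezeSqueeze

end
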